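import Summits.BirchSwinnertonDyer.BirchSwinnertonDyer.Theorems.UniversalToricDescentRoadFFRationalDescent
import HarnessLib

/-!
# Road FF rational descent with a PER-LEVEL exponent: prime avoidance by `p` in `R₀⟦T⟧` and the Krull step
# along `m − e_m → ∞` (kernel brick N1 of memo `Cruxes/TwinSplitIMCAtThreeMult/MEMBER-INCLUSION-AT3-g12.md` §2/§4)

Width seat `bsd-wall-utd-p2-w2` (g3) for the LEAD of `stmt-BirchSwinnertonDyer-20694` / ♭B_T
`stmt-BirchSwinnertonDyer-27172` (route `UniversalToricDescent`, line `membertower`). Pure commutative algebra plus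
its `X^Σ`-level reading; `--supports stmt-BirchSwinnertonDyer-20694`. Nothing is booked; BSD is proved for no curve.

The twisted rational descent of p612782/p613851
(`CongruenceDescent.map_le_span_of_oneSided_congruences_descent_le_of_le_span_mul`,
`AcSelmer.XAc.map_span_mul_fittingIdeal_le_span_of_oneSided_congruences_descent_le_printed'`) asks for ONE twisting
element `a = C(p)^e` for all levels `m` (an `m`-UNIFORM exponent — atom K1b of the member tower). Here the exponent
is PER LEVEL, `a_m = c^{e_m}`, and uniformity is replaced by `limsup (m − e_m) = ∞` together with prime avoidance
by `c` modulo `c^m` in the target ring: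

* §1 (abstract, any commutative ring `S`, element `d`, `L = d^t·L₀` with `d` regular modulo `L₀`):
  `mem_span_of_pow_mul_mem_span` (iterate regularity), `le_sup_span_pow_of_span_pow_mul_le_sup`
  («`d^e·J ⊆ (L₀) + (d)^m ⟹ J ⊆ (L₀) + (d)^{m−e}`», prime avoidance modulo `d^m`),
  `span_pow_mul_le_span_of_forall_perLevel` (Krull along `m − e_m → ∞`: `d^t·F ⊆ (L)`), and across a ring map with
  the congruence step of p612782: `map_span_pow_mul_fittingIdeal_le_span_of_oneSided_congruences_descent_le_perLevel`.
* §2 (`R₀⟦T⟧`): `regular_of_prime_of_not_dvd`, `exists_eq_C_pow_mul_regular_unrSeries` (every `L ∈ R₀⟦T⟧` is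
  `C(p)^t·L₀` with `C(p)` regular modulo `L₀` — `t = μ(L)` for `L ≠ 0`), `regular_C_p_of_isUnit_coeff_unrSeries`
  (`μ(L) = 0 ⟹ t = 0`).
* §3 (`X^Σ`): `AcSelmer.XAc.map_span_C_pow_mul_fittingIdeal_le_span_of_oneSided_congruences_descent_le_printed_perLevel`
  — the member limit ON `X^Σ` at the Fitting level with PER-LEVEL rational member inclusions
  «torsion → `(p^{e_m}·Ch(N_m))·S'_m ⊆ (L_m)`», `limsup (m − e_m) = ∞`, output `(C(p)^t·Fitt₀(X^Σ))·R₀⟦T⟧ ⊆ (L^Σ)`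
  with `t = μ(L^Σ)` (any factorisation `L^Σ = C(p)^t·L₀`, `C(p)` regular mod `L₀`).

References: [Castella2018Erratum] proof of Thm. 1.1 (p. 4), read one-sidedly; [Skinner2016PacificMC] §3.1 (p. 192);
[StacksProject] Tag 05GI (Krull), Tag 07ZA (Fitting ideals).
-/

set_option autoImplicit false

noncomputable section

open scoped Classical TensorProduct

open PowerSeries Literature.NumberTheory.EllipticCurves Literature.NumberTheory.EllipticCurves.Module
  Literature.RingTheory.FittingIdeal NumberField IsDedekindDomain Field
open Summit.BirchSwinnertonDyer.Rank1Residual.X11b.AcSelmer Summit.BirchSwinnertonDyer.Rank1Residual.X11b.Halves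
  Summit.BirchSwinnertonDyer.Rank1Residual.X2

namespace Summit.BirchSwinnertonDyer.Rank1Residual.X11b

/-! ### §1 Prime avoidance modulo `d^m` and the Krull step along `m − e_m → ∞` -/

namespace CongruenceDescent

universe u v w

section Avoidance

variable {S : Type u} [CommRing S]

/-- If `d` is regular modulo `L₀` (`d·y ∈ (L₀) ⟹ y ∈ (L₀)`), then so is every power `d^k`. [folklore] -/
theorem mem_span_of_pow_mul_mem_span {d L₀ : S}
    (hreg : ∀ y : S, d * y ∈ Ideal.span {L₀} → y ∈ Ideal.span {L₀}) :
    ∀ (k : ℕ) (y : S), d ^ k * y ∈ Ideal.span {L₀} → y ∈ Ideal.span {L₀} := by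
  intro k
  induction k with
  | zero =>
      intro y hy
      rwa [pow_zero, one_mul] at hy
  | succ k ih =>
      intro y hy
      rw [pow_succ, mul_assoc] at hy
      exact hreg y (ih (d * y) hy)

/-- **Prime avoidance modulo `d^m`.** If `d` is regular modulo `L₀` and `d^e·J ⊆ (L₀) + (d)^m`, then
`J ⊆ (L₀) + (d)^{m−e}`: from `d^e x = u L₀ + v d^m` one gets `d^e (x − v d^{m−e}) ∈ (L₀)`, whence
`x − v d^{m−e} ∈ (L₀)`. (For `m < e` the conclusion is trivial, `(d)^0 = S`.) [folklore] -/
theorem le_sup_span_pow_of_span_pow_mul_le_sup {d L₀ : S} {e m : ℕ} {J : Ideal S}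
    (hreg : ∀ y : S, d * y ∈ Ideal.span {L₀} → y ∈ Ideal.span {L₀})
    (h : Ideal.span {d ^ e} * J ≤ Ideal.span {L₀} ⊔ Ideal.span {d} ^ m) :
    J ≤ Ideal.span {L₀} ⊔ Ideal.span {d} ^ (m - e) := by
  by_cases hem : e ≤ m
  · intro x hx
    have hx' : d ^ e * x ∈ Ideal.span {L₀} ⊔ Ideal.span {d} ^ m :=
      h (Ideal.mul_mem_mul (Ideal.mem_span_singleton_self _) hx)
    rw [Ideal.span_singleton_pow, Submodule.mem_sup] at hx'
    obtain ⟨u', hu', v', hv', hsum⟩ := hx'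
    obtain ⟨u, rfl⟩ := Ideal.mem_span_singleton'.mp hu'
    obtain ⟨v, rfl⟩ := Ideal.mem_span_singleton'.mp hv'
    have hpow : d ^ m = d ^ e * d ^ (m - e) := by rw [← pow_add, Nat.add_sub_cancel' hem]
    rw [hpow] at hsum
    have hkey : d ^ e * (x - v * d ^ (m - e)) ∈ Ideal.span {L₀} := by
      have hx2 : d ^ e * (x - v * d ^ (m - e)) = u * L₀ := by linear_combination -hsum
      rw [hx2]
      exact Ideal.mul_mem_left _ u (Ideal.mem_span_singleton_self L₀)
    have hx1 := mem_span_of_pow_mul_mem_span hreg e _ hkey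
    rw [Ideal.span_singleton_pow, Submodule.mem_sup]
    exact ⟨x - v * d ^ (m - e), hx1, v * d ^ (m - e),
      Ideal.mul_mem_left _ v (Ideal.mem_span_singleton_self _), by ring⟩
  · rw [Nat.sub_eq_zero_of_le (Nat.le_of_not_ge hem), pow_zero, Ideal.one_eq_top, sup_top_eq]
    exact le_top

/-- **The Krull step along `m − e_m → ∞`.** `S` Noetherian, `(d) ⊆ Jac(S)`, `L = d^t·L₀` with `d` regular modulo
`L₀`; if `d^{e_m}·F ⊆ (L) + (d)^m` for every `m ≥ 1` and `m − e_m` is unbounded, then `d^t·F ⊆ (L)`: for each `n`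
pick `m` with `n + e_m ≤ m`; prime avoidance modulo `d^m` gives `F ⊆ (L₀) + (d)^{m−e_m}`, so
`d^t·F ⊆ (L) + (d)^n`; conclude by Krull's intersection theorem `⋂ₙ ((L) + (d)^n) = (L)`.
[cite: StacksProject, Tag 05GI (Krull's intersection theorem)] -/
theorem span_pow_mul_le_span_of_forall_perLevel [IsNoetherianRing S] {d L L₀ : S} {t : ℕ}
    (hd : Ideal.span {d} ≤ (⊥ : Ideal S).jacobson) (hL : L = d ^ t * L₀)
    (hreg : ∀ y : S, d * y ∈ Ideal.span {L₀} → y ∈ Ideal.span {L₀}) (F : Ideal S) (e : ℕ → ℕ)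
    (hF : ∀ m : ℕ, 1 ≤ m → Ideal.span {d ^ e m} * F ≤ Ideal.span {L} ⊔ Ideal.span {d} ^ m)
    (hunb : ∀ n : ℕ, ∃ m : ℕ, 1 ≤ m ∧ n + e m ≤ m) :
    Ideal.span {d ^ t} * F ≤ Ideal.span {L} := by
  rw [← CongruenceLimit.iInf_sup_pow_eq_self (Ideal.span {d}) (Ideal.span {L}) hd]
  refine le_iInf fun n ↦ ?_
  obtain ⟨m, hm1, hmn⟩ := hunb n
  have hLL₀ : Ideal.span {L} ≤ Ideal.span {L₀} :=
    Ideal.span_singleton_le_span_singleton.mpr ⟨d ^ t, by rw [hL, mul_comm]⟩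
  have h1 : Ideal.span {d ^ e m} * F ≤ Ideal.span {L₀} ⊔ Ideal.span {d} ^ m :=
    (hF m hm1).trans (sup_le_sup_right hLL₀ _)
  have h2 : F ≤ Ideal.span {L₀} ⊔ Ideal.span {d} ^ (m - e m) :=
    le_sup_span_pow_of_span_pow_mul_le_sup hreg h1
  calc Ideal.span {d ^ t} * F
      ≤ Ideal.span {d ^ t} * (Ideal.span {L₀} ⊔ Ideal.span {d} ^ (m - e m)) := Ideal.mul_mono_right h2
    _ = Ideal.span {L} ⊔ Ideal.span {d ^ t} * Ideal.span {d} ^ (m - e m) := by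
        rw [Ideal.mul_sup, Ideal.span_singleton_mul_span_singleton, ← hL]
    _ ≤ Ideal.span {L} ⊔ Ideal.span {d} ^ n :=
        sup_le_sup_left (Ideal.mul_le_left.trans (Ideal.pow_le_pow_right (by omega))) _

end Avoidance

section Descent

variable {R : Type*} [CommRing R] {S : Type u} [CommRing S] (φ : R →+* S) (I : Ideal R)
  {M : Type*} [AddCommGroup M] [Module R M] [Module.Finite R M]

/-- **The one-sided congruence limit with a PER-LEVEL twist `c^{e_m}` and prime avoidance by `c`.** `S` Noetherian,
`I = (c)` with `φ(c) ∈ Jac(S)`, `L = φ(c)^t·L₀` with `φ(c)` regular modulo `L₀`; for every `m ≥ 1` a coefficient square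
with `S'_m` faithfully flat, a finite `R'_m`-module `N_m`, `(R'_m ⊗_R M)/I^m ≅ N_m/I^m`, the TWISTED member inclusion
`(c^{e_m}·Fitt_{R'_m}(N_m))·S'_m ⊆ (L_m)` and `(L_m) ⊆ (L) + I^m S'_m`; and `m − e_m` unbounded. Then
`(c^t·Fitt_R(M))·S ⊆ (L)`. Per level this is the congruence step
`map_span_mul_fittingIdeal_le_sup_of_congruence_descent_le` (p612782) with `a = c^{e_m}`; the limit is
`span_pow_mul_le_span_of_forall_perLevel`. [cite: Skinner2016PacificMC, §3.1 (p. 192)]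
[cite: Castella2018Erratum, proof of Thm. 1.1 (p. 4), read one-sidedly] [cite: StacksProject, Tag 05GI] -/
theorem map_span_pow_mul_fittingIdeal_le_span_of_oneSided_congruences_descent_le_perLevel [IsNoetherianRing S]
    (c : R) (hIc : I = Ideal.span {c}) (hI : I.map φ ≤ (⊥ : Ideal S).jacobson)
    {L L₀ : S} {t : ℕ} (hL : L = φ c ^ t * L₀)
    (hreg : ∀ y : S, φ c * y ∈ Ideal.span {L₀} → y ∈ Ideal.span {L₀})
    (e : ℕ → ℕ) (hunb : ∀ n : ℕ, ∃ m : ℕ, 1 ≤ m ∧ n + e m ≤ m)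
    (R' : ℕ → Type v) [∀ m, CommRing (R' m)] [∀ m, Algebra R (R' m)]
    (S' : ℕ → Type w) [∀ m, CommRing (S' m)] [∀ m, Algebra S (S' m)]
    [∀ m, Module.FaithfullyFlat S (S' m)] (φ' : ∀ m, R' m →+* S' m)
    (hφ' : ∀ m, (φ' m).comp (algebraMap R (R' m)) = (algebraMap S (S' m)).comp φ)
    (N : ℕ → Type*) [∀ m, AddCommGroup (N m)] [∀ m, Module (R' m) (N m)]
    [∀ m, Module.Finite (R' m) (N m)] (Lm : ∀ m, S' m)
    (eqv : ∀ m : ℕ, 1 ≤ m →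
      (((R' m ⊗[R] M) ⧸ ((I.map (algebraMap R (R' m))) ^ m •
          (⊤ : Submodule (R' m) (R' m ⊗[R] M)))) ≃ₗ[R' m]
        (N m ⧸ ((I.map (algebraMap R (R' m))) ^ m • (⊤ : Submodule (R' m) (N m))))))
    (hF : ∀ m : ℕ, 1 ≤ m →
      (Ideal.span {algebraMap R (R' m) (c ^ e m)} * Module.fittingIdeal (R' m) (N m) 0).map (φ' m) ≤
        Ideal.span {Lm m})
    (hc : ∀ m : ℕ, 1 ≤ m →
      Ideal.span {Lm m} ≤
        Ideal.span {algebraMap S (S' m) L} ⊔ ((I.map φ).map (algebraMap S (S' m))) ^ m) :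
    (Ideal.span {c ^ t} * Module.fittingIdeal R M 0).map φ ≤ Ideal.span {L} := by
  have hIφ : I.map φ = Ideal.span {φ c} := by rw [hIc, Ideal.map_span, Set.image_singleton]
  have hmapmul : ∀ x : R, (Ideal.span {x} * Module.fittingIdeal R M 0).map φ =
      Ideal.span {φ x} * (Module.fittingIdeal R M 0).map φ := fun x ↦ by
    rw [Ideal.map_mul, Ideal.map_span, Set.image_singleton]
  rw [hmapmul, map_pow]
  refine span_pow_mul_le_span_of_forall_perLevel (hIφ ▸ hI) hL hreg _ e (fun m hm ↦ ?_) hunb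
  have h := map_span_mul_fittingIdeal_le_sup_of_congruence_descent_le φ I (c ^ e m) (R' m) (S' m) (φ' m)
    (hφ' m) (N m) (eqv m hm) (hF m hm) (hc m hm)
  rwa [hmapmul, map_pow, hIφ] at h

end Descent

/-! ### §2 In `R₀⟦T⟧`: `L = C(p)^t·L₀` with `C(p)` regular modulo `L₀` -/

section Unr

/-- In a domain, a prime `d` not dividing `L₀` is regular modulo `L₀`. [folklore] -/
theorem regular_of_prime_of_not_dvd {S : Type u} [CommRing S] [IsDomain S] {d L₀ : S} (hd : Prime d)
    (hL₀ : ¬ d ∣ L₀) : ∀ y : S, d * y ∈ Ideal.span {L₀} → y ∈ Ideal.span {L₀} := by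
  intro y hy
  rw [Ideal.mem_span_singleton] at hy ⊢
  obtain ⟨u, hu⟩ := hy
  rcases hd.dvd_or_dvd ⟨y, hu.symm⟩ with h | h
  · exact absurd h hL₀
  · obtain ⟨u', rfl⟩ := h
    refine ⟨u', mul_left_cancel₀ hd.ne_zero ?_⟩
    rw [hu]
    ring

variable {p : ℕ} [Fact p.Prime]

/-- **Every `L ∈ R₀⟦T⟧` is `C(p)^t·L₀` with `C(p)` regular modulo `L₀`** (`L = 0`: `t = 0`, `L₀ = 0`, regularity =
`R₀⟦T⟧` is a domain; `L ≠ 0`: `t = μ(L)`, the exact power of the prime `C(p)` dividing `L`, which is finite because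
`R₀⟦T⟧` is a Noetherian domain). [cite: Castella2018, §3 (p. 9)] -/
theorem exists_eq_C_pow_mul_regular_unrSeries (L : UnrSeries p) :
    ∃ (t : ℕ) (L₀ : UnrSeries p), L = (C ((p : ℕ) : unrIntegers p) : UnrSeries p) ^ t * L₀ ∧
      ∀ y : UnrSeries p, (C ((p : ℕ) : unrIntegers p) : UnrSeries p) * y ∈ Ideal.span {L₀} →
        y ∈ Ideal.span {L₀} := by
  haveI := HidaLimitAlgebra.isNoetherianRing_unrSeries (p := p)
  haveI : WfDvdMonoid (UnrSeries p) := IsNoetherianRing.wfDvdMonoid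
  have hprime : Prime (C ((p : ℕ) : unrIntegers p) : UnrSeries p) :=
    prime_C_of_prime prime_natCast_p_unrIntegers
  rcases eq_or_ne L 0 with rfl | hL
  · refine ⟨0, 0, by rw [pow_zero, one_mul], fun y hy ↦ ?_⟩
    rw [Ideal.mem_span_singleton, zero_dvd_iff] at hy ⊢
    exact (mul_eq_zero.mp hy).resolve_left hprime.ne_zero
  · obtain ⟨t, L₀, hndvd, rfl⟩ := WfDvdMonoid.max_power_factor hL hprime.irreducible
    exact ⟨t, L₀, rfl, regular_of_prime_of_not_dvd hprime hndvd⟩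

/-- **`μ(L) = 0 ⟹ C(p)` is regular modulo `L`** (`t = 0`): a series with a unit coefficient is not divisible by the
prime `C(p)` of `R₀⟦T⟧`. [cite: Castella2018, §3 (p. 9)] -/
theorem regular_C_p_of_isUnit_coeff_unrSeries {L : UnrSeries p} (hμ : ∃ i : ℕ, IsUnit (PowerSeries.coeff i L)) :
    ∀ y : UnrSeries p, (C ((p : ℕ) : unrIntegers p) : UnrSeries p) * y ∈ Ideal.span {L} →
      y ∈ Ideal.span {L} := by
  refine regular_of_prime_of_not_dvd (prime_C_of_prime prime_natCast_p_unrIntegers) ?_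
  rintro ⟨M, rfl⟩
  obtain ⟨i, hi⟩ := hμ
  rw [PowerSeries.coeff_C_mul] at hi
  exact (HidaLimitAlgebra.irreducible_natCast_p (p := p)).not_isUnit (isUnit_of_mul_isUnit_left hi)

end Unr

end CongruenceDescent

/-! ### §3 On `X^Σ`: the member limit at the Fitting level with PER-LEVEL rational member inclusions -/

section XAc

variable {K : Type} [Field K] [NumberField K] (E : WeierstrassCurve K) [E.IsElliptic]
  (p : ℕ) [Fact p.Prime] (κ : ZpExtension K p) (𝔭 : HeightOneSpectrum (𝓞 K))
  {S : Set (HeightOneSpectrum (𝓞 K))} (γ : Field.absoluteGaloisGroup K) [Fact (κ.IsTopGenerator γ)]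

universe v w

/-- **The member limit ON `X^Σ` at the Fitting level, PER-LEVEL rational member inclusions, prime avoidance by `p`.**
`Σ` finite; coefficient squares `Λ → R'_m →(φ'_m) S'_m ← R₀⟦T⟧` over Noetherian UFDs `R'_m` with `S'_m` faithfully flat;
finite `R'_m`-modules `N_m` with `(R'_m ⊗_Λ X^Σ)/p^m ≅ N_m/p^m`; the RATIONAL member inclusions «`N_m` torsion →
`(p^{e_m}·Ch_{R'_m}(N_m))·S'_m ⊆ (L_m)`» with a PER-LEVEL exponent `e_m` such that `m − e_m` is unbounded;
`(L_m) ⊆ (L^Σ) + (p^m)`; and a factorisation `L^Σ = C(p)^t·L₀` with `C(p)` regular modulo `L₀`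
(`exists_eq_C_pow_mul_regular_unrSeries`: `t = μ(L^Σ)`; `regular_C_p_of_isUnit_coeff_unrSeries`: `t = 0` when
`μ(L^Σ) = 0`). THEN `(C(p)^t·Fitt₀_Λ(X^Σ))·R₀⟦T⟧ ⊆ (L^Σ)`. The `m`-uniform case `e_m = e` (no avoidance, output twisted
by `C(p)^e`) is p613851's `…_descent_le_printed'`. Pure algebra; CONDITIONAL on the displayed inputs.
[cite: Castella2018Erratum, (2.5) and proof of Thm. 1.1 (p. 4), read one-sidedly]
[cite: Skinner2016PacificMC, §2.6, §3.1 (p. 192)] [cite: StacksProject, Tag 05GI] -/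
theorem AcSelmer.XAc.map_span_C_pow_mul_fittingIdeal_le_span_of_oneSided_congruences_descent_le_printed_perLevel
    (hS : S.Finite) (e : ℕ → ℕ) (hunb : ∀ n : ℕ, ∃ m : ℕ, 1 ≤ m ∧ n + e m ≤ m)
    (LS : UnrSeries p) {t : ℕ} {L₀ : UnrSeries p}
    (hLS : LS = (C ((p : ℕ) : unrIntegers p) : UnrSeries p) ^ t * L₀)
    (hreg : ∀ y : UnrSeries p, (C ((p : ℕ) : unrIntegers p) : UnrSeries p) * y ∈ Ideal.span {L₀} →
      y ∈ Ideal.span {L₀})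
    (R' : ℕ → Type v) [∀ m, CommRing (R' m)]
    [∀ m, IsNoetherianRing (R' m)] [∀ m, IsDomain (R' m)] [∀ m, UniqueFactorizationMonoid (R' m)]
    [∀ m, Algebra (IwasawaAlgebra p) (R' m)]
    (S' : ℕ → Type w) [∀ m, CommRing (S' m)] [∀ m, Algebra (UnrSeries p) (S' m)]
    [∀ m, Module.FaithfullyFlat (UnrSeries p) (S' m)] (φ' : ∀ m, R' m →+* S' m)
    (hφ' : ∀ m, (φ' m).comp (algebraMap (IwasawaAlgebra p) (R' m)) =
      (algebraMap (UnrSeries p) (S' m)).comp (PowerSeries.map (toUnr p)))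
    (N : ℕ → Type) [∀ m, AddCommGroup (N m)] [∀ m, Module (R' m) (N m)]
    [∀ m, Module.Finite (R' m) (N m)] (Lm : ∀ m, S' m)
    (eqv : ∀ m : ℕ, 1 ≤ m →
      (((R' m ⊗[IwasawaAlgebra p] XAc E p κ 𝔭 S γ) ⧸
          (((Ideal.span {(PowerSeries.C (p : ℤ_[p]) : IwasawaAlgebra p)}).map
              (algebraMap (IwasawaAlgebra p) (R' m))) ^ m •
            (⊤ : Submodule (R' m) (R' m ⊗[IwasawaAlgebra p] XAc E p κ 𝔭 S γ)))) ≃ₗ[R' m]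
        (N m ⧸ (((Ideal.span {(PowerSeries.C (p : ℤ_[p]) : IwasawaAlgebra p)}).map
            (algebraMap (IwasawaAlgebra p) (R' m))) ^ m • (⊤ : Submodule (R' m) (N m))))))
    (hCh : ∀ m : ℕ, 1 ≤ m → Module.IsTorsion (R' m) (N m) →
      Ideal.span {φ' m (algebraMap (IwasawaAlgebra p) (R' m)
          ((PowerSeries.C (p : ℤ_[p]) : IwasawaAlgebra p) ^ e m))} *
        (Module.charIdeal (R' m) (N m)).map (φ' m) ≤ Ideal.span {Lm m})
    (hc : ∀ m : ℕ, 1 ≤ m →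
      Ideal.span {Lm m} ≤
        Ideal.span {algebraMap (UnrSeries p) (S' m) LS} ⊔
          (((Ideal.span {(PowerSeries.C (p : ℤ_[p]) : IwasawaAlgebra p)}).map
              (PowerSeries.map (toUnr p))).map (algebraMap (UnrSeries p) (S' m))) ^ m) :
    (Ideal.span {(PowerSeries.C (p : ℤ_[p]) : IwasawaAlgebra p) ^ t} *
        Module.fittingIdeal (IwasawaAlgebra p) (XAc E p κ 𝔭 S γ) 0).map (PowerSeries.map (toUnr p)) ≤
      Ideal.span {LS} := by
  haveI : Module.Finite (IwasawaAlgebra p) (XAc E p κ 𝔭 S γ) := XAc.module_finite κ 𝔭 S γ hS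
  haveI := HidaLimitAlgebra.isNoetherianRing_unrSeries (p := p)
  have hI : (Ideal.span {(PowerSeries.C (p : ℤ_[p]) : IwasawaAlgebra p)}).map
      (PowerSeries.map (toUnr p)) ≤ (⊥ : Ideal (UnrSeries p)).jacobson := by
    rw [HidaLimitAlgebra.map_span_C_p]
    exact HidaLimitAlgebra.span_C_p_le_jacobson_unrSeries
  have hφc : PowerSeries.map (toUnr p) (PowerSeries.C (p : ℤ_[p]) : IwasawaAlgebra p) =
      (C ((p : ℕ) : unrIntegers p) : UnrSeries p) := by
    rw [PowerSeries.map_C, map_natCast]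
  refine CongruenceDescent.map_span_pow_mul_fittingIdeal_le_span_of_oneSided_congruences_descent_le_perLevel
    (PowerSeries.map (toUnr p)) (Ideal.span {(PowerSeries.C (p : ℤ_[p]) : IwasawaAlgebra p)})
    (PowerSeries.C (p : ℤ_[p]) : IwasawaAlgebra p) rfl hI (L := LS) (L₀ := L₀) (t := t)
    (by rw [hφc]; exact hLS) (by rw [hφc]; exact hreg) e hunb R' S' φ' hφ' N Lm eqv
    (fun m hm ↦ CongruenceDescent.map_span_mul_fittingIdeal_le_of_printed_charIdeal_le (φ' m)
      (algebraMap (IwasawaAlgebra p) (R' m) ((PowerSeries.C (p : ℤ_[p]) : IwasawaAlgebra p) ^ e m))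
      (fun hT ↦ by
        rw [Ideal.map_mul, Ideal.map_span, Set.image_singleton]
        exact hCh m hm hT)) hc

end XAc

end Summit.BirchSwinnertonDyer.Rank1Residual.X11b

end
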